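import Summits.QuantumFields.YangMills.Theorems.BalabanUVNodesSpineReadingOfRecord13CoPHKComponentSizeBlocksSkeletonNear
import Summits.QuantumFields.YangMills.Theorems.BalabanUVNodesSpineReadingOfRecord13CoPHKComponentSizeBlocksWindow
import Summits.QuantumFields.YangMills.Theorems.BalabanUVNodesSpineReadingOfRecord13CoPHKComponentSizeBlocksForgive

/-!
# THE SKELETON FACE WITH CONDITIONAL INSIDE LETTERS AT EVERY SATURATION-KEEPING READING OF THE K-KIT — one theorem for any step-preserving dial whose coarse classes keep their
# level-`j` regions block-saturated (`…_of_sat_supNear`), and its instances at the LEVEL-WINDOW reading `windowKeyReading₁₃ K₀ c` and the COMPONENT-WISE FORGIVING reading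
# `forgiveCompReading₁₃ K₀ c` (block levels `lv K j ≤ j`; metric separation `Node00.SupNear`)

Cell `pub-ymgap`, YM-PLAN Track A (HUMAN RULING D-0062; width push D-0149); seat `pub-ymgap-dag-n20-d` (R134 (a) N20 NE7b s3 = the U5d ∕ `crOfRecord₁₃` lineage, its declarer)
gen 34; companion of `…CoPHKComponentSizeBlocksSkeletonNear` (gen 34: `relWeightBound_card_of_condBlockLetters_geometric_supNear`), `…SkeletonCond` (gen 34:
`bad_inside_eq_bad_meets`), `…BlocksWindow` (gen 33: `hsat_windowKeyReading₁₃`, `fst_windowKeyReading₁₃_of_mem_classSet₁₃`) and `…BlocksForgive` (gen 33: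
`hsat_forgiveCompReading₁₃`, `fst_forgiveCompReading₁₃_of_mem_classSet₁₃`).  `--kind proof --supports stmt-QuantumFields-27366 --as helper` (K3⁸); COUNT-NEUTRAL; THEOREMS ONLY
(0 `def`).  [LF-II] = [Balaban1989LargeFieldII].
WHY.  Gen 33 gave the INSIDE-event face at the identity, window and forgiving readings of the K-kit (the three readings the K3 consumers dial); gen 34's conditional INSIDE editions
(`…SkeletonCond ∕ …SkeletonNear`) were stated at the identity reading only.  The conversion INSIDE = MEETS needs just block-saturation of the coarse classes' regions
(`bad_inside_eq_bad_meets`), which every reading of the kit keeps (`hsat_windowKeyReading₁₃`, `hsat_forgiveCompReading₁₃` — the window key's regions are `∅` or the record's, the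
forgiving key's are unions of components of saturated regions).  So: ★★★ `relWeightBound_card_of_condInsideBlockLetters_of_sat_supNear` — ANY step-preserving dial with the
saturation shape `hsat` at the levels `1 ≤ j ≤ jcut K`; ★★★ `…_window_supNear` and ★★★ `…_forgive_supNear` — the two named readings, `lv K j ≤ j`, NO saturation hypothesis left.
§2 adds the PRODUCT socket with INSIDE events and metric separation (no conditioning: «one factor `η` per `ϱ`-separated block» for every member of the separated skeleton family —
the output shape of seat n20-c's «one Peierls factor per skeleton cube»): ★★★ `relWeightBound_card_of_sepInsideBlockLetters_of_sat_supNear` (any saturation-keeping dial) and ★★★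
`…_id_supNear` (identity reading, `lv K j ≤ j`).
HONEST FRAMING.  [folklore] instantiation BY NAME; the one-block conditional INSIDE letters `η K j` are HYPOTHESES (inhabited for no family today; NOT PRINTED as statements about the
RELATIVE (2.18) class weights; LCS-shaped); NO weight is bounded, NO estimate proved; nothing of Bałaban's asserted; NE7 ∕ NE7b ∕ NE7c NOT PRINTED for `d = 4` ∕ NOT proved; no
`Provisos₁₃CoPH` inhabitant claimed (K0⁷ OPEN); K3⁸ v7 untouched; N19 ∕ N20 ∕ N21 ∕ N27 NOT discharged; counts UNMOVED (typed 28∕28 · discharged 8∕27); one finite four-torus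
programme at fixed `ε` — NOT ℝ⁴, NOT OS, NOT a mass gap, NOT the Clay problem.  No `def`, no `instance`, no `notation`, no `sorry`; no decl below carries a cite tag.
-/

noncomputable section

open scoped BigOperators
open Finset

namespace YMDAG.UVSplit

open Literature.MathematicalPhysics.QuantumFieldTheory.Balaban1983to89
open Literature.MathematicalPhysics.QuantumFieldTheory.Balaban1983to89.T4Continuum
open Literature.MathematicalPhysics.QuantumFieldTheory.Balaban1983to89.Node00
open Literature.MathematicalPhysics.QuantumFieldTheory.Balaban1983to89.B5Eq118OneStroke (iterBlockOf iterBlock)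
open T4WeightBudget (RelWeightBound)
open Summit.QuantumFields.YangMills.BalabanUVNodes.N21KeyedShellWeightShellZero (weightA₁₃_nonneg weightB₁₃_nonneg)

variable {F : T4Family} {N : ℕ} [NeZero N]

section Readings

variable (θ : Stage13HParams F N) (hP : θ.Provisos₁₃CoPH F N) (K₀ : ℕ) (g₀ : ℕ → ℝ) (os : List (ULoop F))
  (kr : ℕ → (Σ K, SiteSeqKey F (K₀ + K)) → (Σ K, SiteSeqKey F (K₀ + K))) (jcut : ℕ → ℕ) (ϱ k lv : ℕ → ℕ → ℕ)

/-- ★★★ **THE N20 FACE AT ANY SATURATION-KEEPING STEP-PRESERVING DIAL FROM ONE-BLOCK CONDITIONAL INSIDE LETTERS, METRIC SEPARATION**: if the dial `kr` is step-preserving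
on the classes of record (`hkr`) and its coarse classes keep their level-`j` regions `lv K j`-block-saturated for `1 ≤ j ≤ jcut K` (`hsat`), then conditional INSIDE letters
`0 ≤ η K j ≤ η₀ ≤ 1`, `2·((2ϱ+1)^4·81·(2ϱ+1)^4)²·η K j ≤ 1`, for environments separated from the block by more than `ϱ K j` in some coordinate, in both runs, under the skeleton
schedule `k K j ≥ ⌈log₂ |Site_{lv K j}|⌉ + K + j + 3`, give `RelWeightBound` at the dial's coarse carriers with `W K := η₀ · 2^{−(K+1)}`. [bookkeeping] -/
theorem relWeightBound_card_of_condInsideBlockLetters_of_sat_supNear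
    (hkr : ∀ (K : ℕ) (x : Σ K, SiteSeqKey F (K₀ + K)), x ∈ classSet₁₃ θ K₀ g₀ K → (kr K x).1 = K)
    {η : ℕ → ℕ → ℝ} {η₀ : ℝ} (hη0 : ∀ K j, 0 ≤ η K j) (hη1 : ∀ K j, η K j ≤ η₀) (hη₀ : η₀ ≤ 1)
    (hD : ∀ K j, 2 * ((((2 * ϱ K j + 1) ^ 4 : ℕ) : ℝ) * 3 ^ 4 * ((2 * ϱ K j + 1) ^ 4 : ℕ)) ^ 2 * η K j ≤ 1)
    (hks : ∀ K j, Nat.clog 2 (Fintype.card (Site (F.P (K₀ + K)) (lv K j))) + K + j + 3 ≤ k K j) (hlv : ∀ K j, lv K j ≤ F.m + (K₀ + K))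
    (hsat : ∀ K, ∀ j ∈ Finset.Icc 1 (jcut K), ∀ u ∈ classSetK₁₃ θ K₀ g₀ kr K, ∀ y : SiteSeqKey F (K₀ + K), u = ⟨K, y⟩ →
      ∀ ⦃x x' : Site (F.P (K₀ + K)) 0⦄, iterBlockOf (lv K j) x = iterBlockOf (lv K j) x' → x ∈ (y.2 j)ᶜ → x' ∈ (y.2 j)ᶜ)
    (hCA : ∀ (K : ℕ) (t : ℝ), |t| ≤ 1 → ∀ j ∈ Finset.Icc 1 (jcut K), ∀ (S : Finset (Site (F.P (K₀ + K)) (lv K j))) (b : Site (F.P (K₀ + K)) (lv K j)),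
      b ∉ S → (∀ s ∈ S, ¬ SupNear (ϱ K j) b s) →
      ∑ u ∈ badClassK₁₃ θ K₀ g₀ kr (fun _ u => ∀ y : SiteSeqKey F (K₀ + K), u = ⟨K, y⟩ →
          ∀ b' ∈ insert b S, (↑(iterBlock (lv K j) b') : Set (Site (F.P (K₀ + K)) 0)) ⊆ (y.2 j)ᶜ) K t, weightAK₁₃ θ hP K₀ g₀ os kr K t u ≤
        η K j * ∑ u ∈ badClassK₁₃ θ K₀ g₀ kr (fun _ u => ∀ y : SiteSeqKey F (K₀ + K), u = ⟨K, y⟩ →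
          ∀ b' ∈ S, (↑(iterBlock (lv K j) b') : Set (Site (F.P (K₀ + K)) 0)) ⊆ (y.2 j)ᶜ) K t, weightAK₁₃ θ hP K₀ g₀ os kr K t u)
    (hCB : ∀ (K : ℕ) (t : ℝ), |t| ≤ 1 → ∀ j ∈ Finset.Icc 1 (jcut K), ∀ (S : Finset (Site (F.P (K₀ + K)) (lv K j))) (b : Site (F.P (K₀ + K)) (lv K j)),
      b ∉ S → (∀ s ∈ S, ¬ SupNear (ϱ K j) b s) →
      ∑ u ∈ badClassK₁₃ θ K₀ g₀ kr (fun _ u => ∀ y : SiteSeqKey F (K₀ + K), u = ⟨K, y⟩ →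
          ∀ b' ∈ insert b S, (↑(iterBlock (lv K j) b') : Set (Site (F.P (K₀ + K)) 0)) ⊆ (y.2 j)ᶜ) K t, weightBK₁₃ θ hP K₀ g₀ os kr K t u ≤
        η K j * ∑ u ∈ badClassK₁₃ θ K₀ g₀ kr (fun _ u => ∀ y : SiteSeqKey F (K₀ + K), u = ⟨K, y⟩ →
          ∀ b' ∈ S, (↑(iterBlock (lv K j) b') : Set (Site (F.P (K₀ + K)) 0)) ⊆ (y.2 j)ᶜ) K t, weightBK₁₃ θ hP K₀ g₀ os kr K t u) :
    RelWeightBound 1 (classSetK₁₃ θ K₀ g₀ kr) (weightAK₁₃ θ hP K₀ g₀ os kr) (weightBK₁₃ θ hP K₀ g₀ os kr)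
      (badClassK₁₃ θ K₀ g₀ kr (badKeyReadingOfBigComponent₁₃ N K₀ jcut
        (bigDialOfCard₁₃ K₀ (fun K j => (2 * ϱ K j + 1) ^ 4 * k K j * (F.L ^ 4) ^ lv K j)) F θ hP g₀ os))
      (fun K => η₀ * (1 / 2) ^ (K + 1)) := by
  refine relWeightBound_card_of_condBlockLetters_geometric_supNear θ hP K₀ g₀ os kr jcut ϱ k lv hkr hη0 hη1 hη₀ hD hks hlv ?_ ?_
  · intro K t ht j hj S b hbS hfar
    have h := hCA K t ht j hj S b hbS hfar
    rwa [bad_inside_eq_bad_meets θ K₀ g₀ kr lv K t (hlv K j) (hsat K j hj) (insert b S),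
      bad_inside_eq_bad_meets θ K₀ g₀ kr lv K t (hlv K j) (hsat K j hj) S] at h
  · intro K t ht j hj S b hbS hfar
    have h := hCB K t ht j hj S b hbS hfar
    rwa [bad_inside_eq_bad_meets θ K₀ g₀ kr lv K t (hlv K j) (hsat K j hj) (insert b S),
      bad_inside_eq_bad_meets θ K₀ g₀ kr lv K t (hlv K j) (hsat K j hj) S] at h

variable (c : FloorReading₁₃ N)

/-- ★★★ **… AT THE LEVEL-WINDOW READING `windowKeyReading₁₃ K₀ c`** (any floor reading `c`; block levels `lv K j ≤ j`: NO saturation hypothesis left —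
`hsat_windowKeyReading₁₃`). [bookkeeping] -/
theorem relWeightBound_card_of_condInsideBlockLetters_window_supNear
    {η : ℕ → ℕ → ℝ} {η₀ : ℝ} (hη0 : ∀ K j, 0 ≤ η K j) (hη1 : ∀ K j, η K j ≤ η₀) (hη₀ : η₀ ≤ 1)
    (hD : ∀ K j, 2 * ((((2 * ϱ K j + 1) ^ 4 : ℕ) : ℝ) * 3 ^ 4 * ((2 * ϱ K j + 1) ^ 4 : ℕ)) ^ 2 * η K j ≤ 1)
    (hks : ∀ K j, Nat.clog 2 (Fintype.card (Site (F.P (K₀ + K)) (lv K j))) + K + j + 3 ≤ k K j) (hlv : ∀ K j, lv K j ≤ F.m + (K₀ + K))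
    (hlvj : ∀ K, ∀ j ∈ Finset.Icc 1 (jcut K), lv K j ≤ j)
    (hCA : ∀ (K : ℕ) (t : ℝ), |t| ≤ 1 → ∀ j ∈ Finset.Icc 1 (jcut K), ∀ (S : Finset (Site (F.P (K₀ + K)) (lv K j))) (b : Site (F.P (K₀ + K)) (lv K j)),
      b ∉ S → (∀ s ∈ S, ¬ SupNear (ϱ K j) b s) →
      ∑ u ∈ badClassK₁₃ θ K₀ g₀ (windowKeyReading₁₃ K₀ c F θ hP g₀ os) (fun _ u => ∀ y : SiteSeqKey F (K₀ + K), u = ⟨K, y⟩ →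
          ∀ b' ∈ insert b S, (↑(iterBlock (lv K j) b') : Set (Site (F.P (K₀ + K)) 0)) ⊆ (y.2 j)ᶜ) K t,
          weightAK₁₃ θ hP K₀ g₀ os (windowKeyReading₁₃ K₀ c F θ hP g₀ os) K t u ≤
        η K j * ∑ u ∈ badClassK₁₃ θ K₀ g₀ (windowKeyReading₁₃ K₀ c F θ hP g₀ os) (fun _ u => ∀ y : SiteSeqKey F (K₀ + K), u = ⟨K, y⟩ →
          ∀ b' ∈ S, (↑(iterBlock (lv K j) b') : Set (Site (F.P (K₀ + K)) 0)) ⊆ (y.2 j)ᶜ) K t, weightAK₁₃ θ hP K₀ g₀ os (windowKeyReading₁₃ K₀ c F θ hP g₀ os) K t u)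
    (hCB : ∀ (K : ℕ) (t : ℝ), |t| ≤ 1 → ∀ j ∈ Finset.Icc 1 (jcut K), ∀ (S : Finset (Site (F.P (K₀ + K)) (lv K j))) (b : Site (F.P (K₀ + K)) (lv K j)),
      b ∉ S → (∀ s ∈ S, ¬ SupNear (ϱ K j) b s) →
      ∑ u ∈ badClassK₁₃ θ K₀ g₀ (windowKeyReading₁₃ K₀ c F θ hP g₀ os) (fun _ u => ∀ y : SiteSeqKey F (K₀ + K), u = ⟨K, y⟩ →
          ∀ b' ∈ insert b S, (↑(iterBlock (lv K j) b') : Set (Site (F.P (K₀ + K)) 0)) ⊆ (y.2 j)ᶜ) K t,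
          weightBK₁₃ θ hP K₀ g₀ os (windowKeyReading₁₃ K₀ c F θ hP g₀ os) K t u ≤
        η K j * ∑ u ∈ badClassK₁₃ θ K₀ g₀ (windowKeyReading₁₃ K₀ c F θ hP g₀ os) (fun _ u => ∀ y : SiteSeqKey F (K₀ + K), u = ⟨K, y⟩ →
          ∀ b' ∈ S, (↑(iterBlock (lv K j) b') : Set (Site (F.P (K₀ + K)) 0)) ⊆ (y.2 j)ᶜ) K t, weightBK₁₃ θ hP K₀ g₀ os (windowKeyReading₁₃ K₀ c F θ hP g₀ os) K t u) :
    RelWeightBound 1 (classSetK₁₃ θ K₀ g₀ (windowKeyReading₁₃ K₀ c F θ hP g₀ os)) (weightAK₁₃ θ hP K₀ g₀ os (windowKeyReading₁₃ K₀ c F θ hP g₀ os))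
      (weightBK₁₃ θ hP K₀ g₀ os (windowKeyReading₁₃ K₀ c F θ hP g₀ os))
      (badClassK₁₃ θ K₀ g₀ (windowKeyReading₁₃ K₀ c F θ hP g₀ os) (badKeyReadingOfBigComponent₁₃ N K₀ jcut
        (bigDialOfCard₁₃ K₀ (fun K j => (2 * ϱ K j + 1) ^ 4 * k K j * (F.L ^ 4) ^ lv K j)) F θ hP g₀ os))
      (fun K => η₀ * (1 / 2) ^ (K + 1)) :=
  relWeightBound_card_of_condInsideBlockLetters_of_sat_supNear θ hP K₀ g₀ os (windowKeyReading₁₃ K₀ c F θ hP g₀ os) jcut ϱ k lv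
    (fun K x hx => fst_windowKeyReading₁₃_of_mem_classSet₁₃ θ hP K₀ g₀ os c K x hx) hη0 hη1 hη₀ hD hks hlv
    (fun K j hj => hsat_windowKeyReading₁₃ θ hP K₀ g₀ os c lv hlv K j (hlvj K j hj)) hCA hCB

/-- ★★★ **… AT THE COMPONENT-WISE FORGIVING READING `forgiveCompReading₁₃ K₀ c`** (any floor reading `c`; block levels `lv K j ≤ j`: NO saturation hypothesis left —
`hsat_forgiveCompReading₁₃`: blocks are `SiteTouch`-connected, so components of saturated regions are saturated). [bookkeeping] -/
theorem relWeightBound_card_of_condInsideBlockLetters_forgive_supNear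
    {η : ℕ → ℕ → ℝ} {η₀ : ℝ} (hη0 : ∀ K j, 0 ≤ η K j) (hη1 : ∀ K j, η K j ≤ η₀) (hη₀ : η₀ ≤ 1)
    (hD : ∀ K j, 2 * ((((2 * ϱ K j + 1) ^ 4 : ℕ) : ℝ) * 3 ^ 4 * ((2 * ϱ K j + 1) ^ 4 : ℕ)) ^ 2 * η K j ≤ 1)
    (hks : ∀ K j, Nat.clog 2 (Fintype.card (Site (F.P (K₀ + K)) (lv K j))) + K + j + 3 ≤ k K j) (hlv : ∀ K j, lv K j ≤ F.m + (K₀ + K))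
    (hlvj : ∀ K, ∀ j ∈ Finset.Icc 1 (jcut K), lv K j ≤ j)
    (hCA : ∀ (K : ℕ) (t : ℝ), |t| ≤ 1 → ∀ j ∈ Finset.Icc 1 (jcut K), ∀ (S : Finset (Site (F.P (K₀ + K)) (lv K j))) (b : Site (F.P (K₀ + K)) (lv K j)),
      b ∉ S → (∀ s ∈ S, ¬ SupNear (ϱ K j) b s) →
      ∑ u ∈ badClassK₁₃ θ K₀ g₀ (forgiveCompReading₁₃ K₀ c F θ hP g₀ os) (fun _ u => ∀ y : SiteSeqKey F (K₀ + K), u = ⟨K, y⟩ →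
          ∀ b' ∈ insert b S, (↑(iterBlock (lv K j) b') : Set (Site (F.P (K₀ + K)) 0)) ⊆ (y.2 j)ᶜ) K t,
          weightAK₁₃ θ hP K₀ g₀ os (forgiveCompReading₁₃ K₀ c F θ hP g₀ os) K t u ≤
        η K j * ∑ u ∈ badClassK₁₃ θ K₀ g₀ (forgiveCompReading₁₃ K₀ c F θ hP g₀ os) (fun _ u => ∀ y : SiteSeqKey F (K₀ + K), u = ⟨K, y⟩ →
          ∀ b' ∈ S, (↑(iterBlock (lv K j) b') : Set (Site (F.P (K₀ + K)) 0)) ⊆ (y.2 j)ᶜ) K t, weightAK₁₃ θ hP K₀ g₀ os (forgiveCompReading₁₃ K₀ c F θ hP g₀ os) K t u)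
    (hCB : ∀ (K : ℕ) (t : ℝ), |t| ≤ 1 → ∀ j ∈ Finset.Icc 1 (jcut K), ∀ (S : Finset (Site (F.P (K₀ + K)) (lv K j))) (b : Site (F.P (K₀ + K)) (lv K j)),
      b ∉ S → (∀ s ∈ S, ¬ SupNear (ϱ K j) b s) →
      ∑ u ∈ badClassK₁₃ θ K₀ g₀ (forgiveCompReading₁₃ K₀ c F θ hP g₀ os) (fun _ u => ∀ y : SiteSeqKey F (K₀ + K), u = ⟨K, y⟩ →
          ∀ b' ∈ insert b S, (↑(iterBlock (lv K j) b') : Set (Site (F.P (K₀ + K)) 0)) ⊆ (y.2 j)ᶜ) K t,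
          weightBK₁₃ θ hP K₀ g₀ os (forgiveCompReading₁₃ K₀ c F θ hP g₀ os) K t u ≤
        η K j * ∑ u ∈ badClassK₁₃ θ K₀ g₀ (forgiveCompReading₁₃ K₀ c F θ hP g₀ os) (fun _ u => ∀ y : SiteSeqKey F (K₀ + K), u = ⟨K, y⟩ →
          ∀ b' ∈ S, (↑(iterBlock (lv K j) b') : Set (Site (F.P (K₀ + K)) 0)) ⊆ (y.2 j)ᶜ) K t, weightBK₁₃ θ hP K₀ g₀ os (forgiveCompReading₁₃ K₀ c F θ hP g₀ os) K t u) :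
    RelWeightBound 1 (classSetK₁₃ θ K₀ g₀ (forgiveCompReading₁₃ K₀ c F θ hP g₀ os)) (weightAK₁₃ θ hP K₀ g₀ os (forgiveCompReading₁₃ K₀ c F θ hP g₀ os))
      (weightBK₁₃ θ hP K₀ g₀ os (forgiveCompReading₁₃ K₀ c F θ hP g₀ os))
      (badClassK₁₃ θ K₀ g₀ (forgiveCompReading₁₃ K₀ c F θ hP g₀ os) (badKeyReadingOfBigComponent₁₃ N K₀ jcut
        (bigDialOfCard₁₃ K₀ (fun K j => (2 * ϱ K j + 1) ^ 4 * k K j * (F.L ^ 4) ^ lv K j)) F θ hP g₀ os))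
      (fun K => η₀ * (1 / 2) ^ (K + 1)) :=
  relWeightBound_card_of_condInsideBlockLetters_of_sat_supNear θ hP K₀ g₀ os (forgiveCompReading₁₃ K₀ c F θ hP g₀ os) jcut ϱ k lv
    (fun K x hx => fst_forgiveCompReading₁₃_of_mem_classSet₁₃ θ hP K₀ g₀ os c K x hx) hη0 hη1 hη₀ hD hks hlv
    (fun K j hj => hsat_forgiveCompReading₁₃ θ hP K₀ g₀ os c lv hlv K j (hlvj K j hj)) hCA hCB

end Readings

/-! ## §2 The PRODUCT socket with INSIDE events and metric separation (one Peierls factor per separated block, no conditioning) -/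

section Product

variable (θ : Stage13HParams F N) (hP : θ.Provisos₁₃CoPH F N) (K₀ : ℕ) (g₀ : ℕ → ℝ) (os : List (ULoop F))
  (kr : ℕ → (Σ K, SiteSeqKey F (K₀ + K)) → (Σ K, SiteSeqKey F (K₀ + K))) (jcut : ℕ → ℕ) (ϱ k lv : ℕ → ℕ → ℕ)

/-- ★★★ **THE N20 FACE FROM PRODUCT INSIDE LETTERS ON METRICALLY SEPARATED FAMILIES, AT ANY SATURATION-KEEPING STEP-PRESERVING DIAL** (the socket for a supplier that delivers
«one factor `η K j` per `ϱ K j`-separated block» as a product bound, e.g. seat n20-c's «one Peierls factor per skeleton cube», rather than a conditional bound): for every member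
`(y₀, A)` of the separated skeleton family `sepAnimalCoverFamily SiteTouch (SupNear (ϱ K j)) (k K j)` the coarse classes whose level-`j` region CONTAINS every block of `A` weigh at
most `η K j ^ (k K j)` of the run's total, in both runs; numerics and schedule as in the conditional editions; `hsat` = block-saturation of the coarse classes' regions.
[bookkeeping] -/
theorem relWeightBound_card_of_sepInsideBlockLetters_of_sat_supNear
    (hkr : ∀ (K : ℕ) (x : Σ K, SiteSeqKey F (K₀ + K)), x ∈ classSet₁₃ θ K₀ g₀ K → (kr K x).1 = K)
    {η : ℕ → ℕ → ℝ} {η₀ : ℝ} (hη0 : ∀ K j, 0 ≤ η K j) (hη1 : ∀ K j, η K j ≤ η₀) (hη₀ : η₀ ≤ 1)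
    (hD : ∀ K j, 2 * ((((2 * ϱ K j + 1) ^ 4 : ℕ) : ℝ) * 3 ^ 4 * ((2 * ϱ K j + 1) ^ 4 : ℕ)) ^ 2 * η K j ≤ 1)
    (hks : ∀ K j, Nat.clog 2 (Fintype.card (Site (F.P (K₀ + K)) (lv K j))) + K + j + 3 ≤ k K j) (hlv : ∀ K j, lv K j ≤ F.m + (K₀ + K))
    (hsat : ∀ K, ∀ j ∈ Finset.Icc 1 (jcut K), ∀ u ∈ classSetK₁₃ θ K₀ g₀ kr K, ∀ y : SiteSeqKey F (K₀ + K), u = ⟨K, y⟩ →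
      ∀ ⦃x x' : Site (F.P (K₀ + K)) 0⦄, iterBlockOf (lv K j) x = iterBlockOf (lv K j) x' → x ∈ (y.2 j)ᶜ → x' ∈ (y.2 j)ᶜ)
    (hEA : ∀ (K : ℕ) (t : ℝ), |t| ≤ 1 → ∀ j ∈ Finset.Icc 1 (jcut K),
      ∀ p ∈ sepAnimalCoverFamily (SiteTouch (P := F.P (K₀ + K)) (j := lv K j)) (SupNear (P := F.P (K₀ + K)) (j := lv K j) (ϱ K j)) (k K j),
      ∑ u ∈ badClassK₁₃ θ K₀ g₀ kr (fun _ u => ∀ y : SiteSeqKey F (K₀ + K), u = ⟨K, y⟩ →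
          ∀ b ∈ p.2, (↑(iterBlock (lv K j) b) : Set (Site (F.P (K₀ + K)) 0)) ⊆ (y.2 j)ᶜ) K t, weightAK₁₃ θ hP K₀ g₀ os kr K t u ≤
        η K j ^ k K j * ∑ u ∈ classSetK₁₃ θ K₀ g₀ kr K, weightAK₁₃ θ hP K₀ g₀ os kr K t u)
    (hEB : ∀ (K : ℕ) (t : ℝ), |t| ≤ 1 → ∀ j ∈ Finset.Icc 1 (jcut K),
      ∀ p ∈ sepAnimalCoverFamily (SiteTouch (P := F.P (K₀ + K)) (j := lv K j)) (SupNear (P := F.P (K₀ + K)) (j := lv K j) (ϱ K j)) (k K j),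
      ∑ u ∈ badClassK₁₃ θ K₀ g₀ kr (fun _ u => ∀ y : SiteSeqKey F (K₀ + K), u = ⟨K, y⟩ →
          ∀ b ∈ p.2, (↑(iterBlock (lv K j) b) : Set (Site (F.P (K₀ + K)) 0)) ⊆ (y.2 j)ᶜ) K t, weightBK₁₃ θ hP K₀ g₀ os kr K t u ≤
        η K j ^ k K j * ∑ u ∈ classSetK₁₃ θ K₀ g₀ kr K, weightBK₁₃ θ hP K₀ g₀ os kr K t u) :
    RelWeightBound 1 (classSetK₁₃ θ K₀ g₀ kr) (weightAK₁₃ θ hP K₀ g₀ os kr) (weightBK₁₃ θ hP K₀ g₀ os kr)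
      (badClassK₁₃ θ K₀ g₀ kr (badKeyReadingOfBigComponent₁₃ N K₀ jcut
        (bigDialOfCard₁₃ K₀ (fun K j => (2 * ϱ K j + 1) ^ 4 * k K j * (F.L ^ 4) ^ lv K j)) F θ hP g₀ os))
      (fun K => η₀ * (1 / 2) ^ (K + 1)) :=
  relWeightBound_card_of_sepBlockLetters_geometric θ hP K₀ g₀ os kr jcut (fun K j => (2 * ϱ K j + 1) ^ 4) k lv (fun K j => SupNear (ϱ K j)) hkr
    hη0 hη1 hη₀ hD hks hlv (fun K j => supNear_refl (ϱ K j)) (fun K j => supNear_symm (ϱ K j)) (fun K j => exists_cover_supNear_four K₀ ϱ lv K j)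
    (fun K t ht j hj p hp => meetsLetter_of_insideLetter θ K₀ g₀ kr lv K t (hsat K j hj) _
      (fun u _ => weightAK₁₃_nonneg θ hP K₀ g₀ os kr (fun x _ => weightA₁₃_nonneg F θ hP K₀ g₀ os K t x) u) p.2 (hEA K t ht j hj p hp))
    (fun K t ht j hj p hp => meetsLetter_of_insideLetter θ K₀ g₀ kr lv K t (hsat K j hj) _
      (fun u _ => weightBK₁₃_nonneg θ hP K₀ g₀ os kr (fun x _ => weightB₁₃_nonneg F θ hP K₀ g₀ os K t x) u) p.2 (hEB K t ht j hj p hp))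

/-- ★★★ **… AT THE IDENTITY KEY READING, `lv K j ≤ j`: NO saturation hypothesis left** — product INSIDE letters on `ϱ`-separated skeleton families at the classes of record give
`RelWeightBound` at the record's carriers with `W K := η₀ · 2^{−(K+1)}`. [bookkeeping] -/
theorem relWeightBound_card_of_sepInsideBlockLetters_id_supNear
    {η : ℕ → ℕ → ℝ} {η₀ : ℝ} (hη0 : ∀ K j, 0 ≤ η K j) (hη1 : ∀ K j, η K j ≤ η₀) (hη₀ : η₀ ≤ 1)
    (hD : ∀ K j, 2 * ((((2 * ϱ K j + 1) ^ 4 : ℕ) : ℝ) * 3 ^ 4 * ((2 * ϱ K j + 1) ^ 4 : ℕ)) ^ 2 * η K j ≤ 1)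
    (hks : ∀ K j, Nat.clog 2 (Fintype.card (Site (F.P (K₀ + K)) (lv K j))) + K + j + 3 ≤ k K j) (hlv : ∀ K j, lv K j ≤ F.m + (K₀ + K))
    (hlvj : ∀ K, ∀ j ∈ Finset.Icc 1 (jcut K), lv K j ≤ j)
    (hEA : ∀ (K : ℕ) (t : ℝ), |t| ≤ 1 → ∀ j ∈ Finset.Icc 1 (jcut K),
      ∀ p ∈ sepAnimalCoverFamily (SiteTouch (P := F.P (K₀ + K)) (j := lv K j)) (SupNear (P := F.P (K₀ + K)) (j := lv K j) (ϱ K j)) (k K j),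
      ∑ u ∈ badClassK₁₃ θ K₀ g₀ (fun _ x => x) (fun _ u => ∀ y : SiteSeqKey F (K₀ + K), u = ⟨K, y⟩ →
          ∀ b ∈ p.2, (↑(iterBlock (lv K j) b) : Set (Site (F.P (K₀ + K)) 0)) ⊆ (y.2 j)ᶜ) K t, weightAK₁₃ θ hP K₀ g₀ os (fun _ x => x) K t u ≤
        η K j ^ k K j * ∑ u ∈ classSetK₁₃ θ K₀ g₀ (fun _ x => x) K, weightAK₁₃ θ hP K₀ g₀ os (fun _ x => x) K t u)
    (hEB : ∀ (K : ℕ) (t : ℝ), |t| ≤ 1 → ∀ j ∈ Finset.Icc 1 (jcut K),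
      ∀ p ∈ sepAnimalCoverFamily (SiteTouch (P := F.P (K₀ + K)) (j := lv K j)) (SupNear (P := F.P (K₀ + K)) (j := lv K j) (ϱ K j)) (k K j),
      ∑ u ∈ badClassK₁₃ θ K₀ g₀ (fun _ x => x) (fun _ u => ∀ y : SiteSeqKey F (K₀ + K), u = ⟨K, y⟩ →
          ∀ b ∈ p.2, (↑(iterBlock (lv K j) b) : Set (Site (F.P (K₀ + K)) 0)) ⊆ (y.2 j)ᶜ) K t, weightBK₁₃ θ hP K₀ g₀ os (fun _ x => x) K t u ≤
        η K j ^ k K j * ∑ u ∈ classSetK₁₃ θ K₀ g₀ (fun _ x => x) K, weightBK₁₃ θ hP K₀ g₀ os (fun _ x => x) K t u) :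
    RelWeightBound 1 (classSetK₁₃ θ K₀ g₀ (keyReadingId₁₃ N K₀ F θ hP g₀ os)) (weightAK₁₃ θ hP K₀ g₀ os (keyReadingId₁₃ N K₀ F θ hP g₀ os))
      (weightBK₁₃ θ hP K₀ g₀ os (keyReadingId₁₃ N K₀ F θ hP g₀ os))
      (badClassK₁₃ θ K₀ g₀ (keyReadingId₁₃ N K₀ F θ hP g₀ os) (badKeyReadingOfBigComponent₁₃ N K₀ jcut
        (bigDialOfCard₁₃ K₀ (fun K j => (2 * ϱ K j + 1) ^ 4 * k K j * (F.L ^ 4) ^ lv K j)) F θ hP g₀ os))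
      (fun K => η₀ * (1 / 2) ^ (K + 1)) :=
  relWeightBound_card_of_sepInsideBlockLetters_of_sat_supNear θ hP K₀ g₀ os (fun _ x => x) jcut ϱ k lv (fun _ _ hx => fst_eq_of_mem_classSet₁₃ θ K₀ g₀ hx)
    hη0 hη1 hη₀ hD hks hlv (fun K j hj => hsat_keyReadingId₁₃ θ K₀ g₀ lv hlv K j (hlvj K j hj)) hEA hEB

end Product

end YMDAG.UVSplit

end
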